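import Summits.Ventures.HodgeRepro2.T6N41TauHyp

/-!
# T6N41TauMain — Proposition N*'s hypothesis (i) on the forced `τ′`-vector from the Rallis inner-product formula (Tier 6, M2; proof lane; owner t6-p4)

`TauDatum.hypI_of_rallis`: on one side of the seesaw, from N4's conclusion `(R1) ∧ (H_loc)` (`NSide.R1AndHloc`,
the conclusion of `NSide.R1AndHloc_of`), t6-p5's zeta form of N4.2 (`FinitePlacesDatum.ZetaNonzeroEverywhere`,
the conclusion of `N42Main.N42_zeta_main`: `Z_v^*(½) ≢ 0` on `R(V_v) ⊗ π₀,v^∨ ⊗ π₀,v` at every finite place, from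
GQT Prop. 11.6(i) = the display `GQT2014_Prop35_i`), N4.3's archimedean non-vanishing `Z^*_{τ′_j}(½) ≠ 0`
(`NSide.ArchNonvanishing`, the conclusion of `N43Places.archNonvanishing_withLfac`) and the two displays of
T6N41TauHyp consumed BY NAME — GQT Theorem 11.4(ii) with (11.3), §11.6's unramified identity — the lift is
non-zero ON a `τ′`-vector: `N3Side.hypI`.  This is the residual `hτ' : σ ≠ ⊥ → hypI` of `N4_main` (class IR),
narrowed to print: the bookkeeping in kernel is (1) the CHOICE of the finite test data — at a finite place of
`S` a triple on which the trilinear form `Z_v^*(½)` is non-zero (it exists since the form is not identically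
zero: `ZetaDatum.exists_test_of_nonzero`), off `S` the unramified datum (`Z_v^* = 1/d_v(½, χ_V) ≠ 0`, §11.6) —
assembled with the forced archimedean data into a restricted pure tensor; (2) every local factor of the assembled datum is non-zero (N4.3 at the real places); (3) an absolutely
convergent product of non-zero factors is non-zero (Mathlib's `tprod_one_add_ne_zero_of_summable`); (4) the
formula: `⟨θ(φ₁,f₁), θ(φ₂,f₂)⟩ = [E : F] · L(1, π × χ_V) · ∏_v Z_v^*` with `[E : F] = 2 ≠ 0`, `L(1) ≠ 0` by (R1)
and the product non-zero — so `θ(φ₁, f₁) ≠ 0` (a vector whose pairing with something is non-zero is non-zero),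
with `f₁ ∈ π₀ ⊓ τ′iso` by construction.  Record: MEMO-route-2 §15.4 (R2)–(R3) / TIER5 N3 l. 1059.

`#print axioms TauDatum.hypI_of_rallis` = {propext, Classical.choice, Quot.sound}.  §8(d): uses an L-value-free
non-vanishing device: NO.
-/

namespace Summit.Ventures.HodgeRepro2.T6
namespace N41Tau

/-- An absolutely convergent infinite product of non-zero complex numbers is non-zero (Mathlib's
`tprod_one_add_ne_zero_of_summable` on `f − 1`). -/
theorem tprod_ne_zero {ι : Type*} {f : ι → ℂ} (hf : ∀ w, f w ≠ 0) (hs : Summable fun w => ‖f w - 1‖) :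
    ∏' w, f w ≠ 0 := by
  have h := tprod_one_add_ne_zero_of_summable (f := fun w => f w - 1) (fun w => by simpa using hf w) hs
  simpa using h

end N41Tau

namespace TauDatum

open scoped InnerProductSpace

variable {LG : Type} [NormedAddCommGroup LG] [InnerProductSpace ℂ LG] {Gf : Type} [Group Gf]
  {X : N3Side LG Gf} {s : NSide} (Td : TauDatum X s)

/-- A trilinear form that is not identically zero takes a non-zero value on some triple. -/
theorem _root_.Summit.Ventures.HodgeRepro2.T6.N42Defs.ZetaDatum.exists_test_of_nonzero
    {S : N42Defs.DualPairDatum} (Z : N42Defs.ZetaDatum S) (h : Z.Nonzero) :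
    ∃ (r : Z.R) (d : Z.Vdual) (p : S.Vπ), Z.Zstar (1 / 2) r d p ≠ 0 := by
  by_contra hcon
  apply h
  ext r d p
  simp only [LinearMap.zero_apply]
  by_contra hne
  exact hcon ⟨r, d, p, hne⟩

/-- A finite place of the datum where `Z_v^*(½) ≢ 0` carries a local test datum with non-zero value. -/
theorem _root_.Summit.Ventures.HodgeRepro2.T6.NSide.exists_localTest_of_zetaNonzero (s : NSide)
    {v : s.d42.Place} (h : s.d42.ZetaNonzeroAt v) : ∃ t : s.LocalTest v, s.zvalue v t ≠ 0 := by
  obtain ⟨r, d, p, hne⟩ := ((s.zetaPair v).2).exists_test_of_nonzero ((s.zetaNonzeroAt_iff v).1 h)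
  exact ⟨(r, d, p), hne⟩

open scoped Classical in
/-- The chosen family of local finite test data: at a finite place of `S` a triple on which `Z_v^*(½)` is
non-zero — it exists by t6-p5's zeta form of N4.2 at `v` — and off `S` the unramified datum. -/
noncomputable def choice (hZ : s.d42.ZetaNonzeroEverywhere) : ∀ v, s.LocalTest v :=
  fun v =>
    if _h : Sum.inl v ∈ s.d41.S then
      Classical.choose (s.exists_localTest_of_zetaNonzero ((s.d42.zetaNonzeroEverywhere_iff.1 hZ) v))
    else Td.sph v

/-- The chosen family is restricted (spherical off `S`). -/
theorem choice_restricted (hZ : s.d42.ZetaNonzeroEverywhere) : Td.Restricted (Td.choice hZ) := by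
  intro v hv
  unfold choice
  rw [dif_neg hv]

/-- `Z_v^*(½)` is non-zero on the chosen local datum at every finite place: by the choice at `v ∈ S`, by
§11.6's unramified identity and `d_v(½, χ_V) ≠ 0` off `S`. -/
theorem zvalue_choice_ne_zero (hU : Hyp.GQT2014_Sec11_6_Unramified Td) (hZ : s.d42.ZetaNonzeroEverywhere)
    (v : s.d42.Place) : s.zvalue v (Td.choice hZ v) ≠ 0 := by
  unfold choice
  split_ifs with h
  · exact Classical.choose_spec (s.exists_localTest_of_zetaNonzero ((s.d42.zetaNonzeroEverywhere_iff.1 hZ) v))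
  · rw [hU v h]
    exact inv_ne_zero (Td.dv_ne_zero v h)

/-- Every local factor of the assembled pure tensor is non-zero: the finite places by
`zvForm_choice_ne_zero`, the real places by N4.3 (`Z^*_{τ′_j}(½) ≠ 0`). -/
theorem loc_assemble_choice_ne_zero (hU : Hyp.GQT2014_Sec11_6_Unramified Td)
    (hZ : s.d42.ZetaNonzeroEverywhere) (harch : s.ArchNonvanishing) :
    ∀ w, (Td.assemble (Td.choice hZ)).loc w ≠ 0 := by
  intro w
  rcases w with v | j
  · rw [Td.assemble_loc_fin]
    exact Td.zvalue_choice_ne_zero hU hZ v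
  · rw [Td.assemble_loc_arch]
    exact harch j

/-- **Hypothesis (i) of Proposition N* on the forced `τ′`-vector.**  From `(R1) ∧ (H_loc)`, t6-p5's zeta form
of N4.2, N4.3's archimedean non-vanishing and the two GQT displays by name: `∃ f ∈ π₀ ⊓ τ′iso, ∃ φ, Θ φ f ≠ 0`. -/
theorem hypI_of_rallis (hRIP : Hyp.GQT2014_Thm11_4_ii_Rallis Td) (hU : Hyp.GQT2014_Sec11_6_Unramified Td)
    (h : s.R1AndHloc) (hZ : s.d42.ZetaNonzeroEverywhere) (harch : s.ArchNonvanishing) : X.hypI := by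
  obtain ⟨hR1, hloc⟩ := h
  set x := Td.choice hZ with hx
  set p := Td.assemble x with hpdef
  have hp : p ∈ Td.Pure := Td.assemble_mem (Td.choice_restricted hZ)
  obtain ⟨hsum, hform⟩ := hRIP hloc p hp
  have hprod : ∏' w, p.loc w ≠ 0 :=
    N41Tau.tprod_ne_zero (Td.loc_assemble_choice_ne_zero hU hZ harch) hsum
  have hinner : ⟪X.Θ p.φ₂ p.f₂, X.Θ p.φ₁ p.f₁⟫_ℂ ≠ 0 := by
    rw [hform]
    exact mul_ne_zero (mul_ne_zero two_ne_zero hR1.2) hprod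
  have hΘ : X.Θ p.φ₁ p.f₁ ≠ 0 := by
    intro h0
    apply hinner
    rw [h0, inner_zero_right]
  exact ⟨p.f₁, Td.assemble_f₁_mem x, p.φ₁, hΘ⟩

end TauDatum
end Summit.Ventures.HodgeRepro2.T6
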